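import Mathlib
import Literature.NumberTheory.LFunctions.Zhang2022.Section12Top1225ExWindow
import Literature.NumberTheory.LFunctions.Zhang2022.Section8RangeEngine
import Literature.NumberTheory.LFunctions.Zhang2022.Section8FrontEnd810
import Literature.NumberTheory.LFunctions.Zhang2022.Section8ChangeOfVariables
import Literature.NumberTheory.LFunctions.Zhang2022.Section9GatheringCore
import HarnessLib

/-!
# Zhang (2022) §12 (12.13), exact reading: the top range of `S_j(𝐚₁₂,𝐚₂₅)` — (8.10) and the
# window-sum → integral step for the gathered main term

Topic `Literature/NumberTheory/LFunctions/Zhang2022` (Landau–Siegel audit tree; verdict-neutral).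
Y. Zhang, *Discrete mean estimates and the Landau–Siegel zero*, arXiv:2211.02515v1 (2022)
[Zhang2022LandauSiegel] — **an unrefereed manuscript under adjudication; theorem-only file, nothing here
bears on its Theorems 1–2** (lane ZHANG-L, WP12, seat zl-w12-p6; node `Typed.Sec12C.Top1225Ex`, RT-02).
Fourth layer of "the sum over `P″₁ < dr < P₂` is equal to … `Σ_{P^{0.496}<n<P^{0.498}}|χ(n)|λ₀ⱼ(n)φ(n)⁻¹
𝓕_{j6}(P^{0.498}/n)𝓦_j(n)` … `= (𝔞ῑ₃/((0.504)(0.498)log P))∫…dz + …`" (p. 71, tex L3614–L3622):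

* `profile_bounds` — the profiles `t ↦ 𝓕_{jμ}(P_k/t)𝓦ˣ_j(t)` are `C¹` on `[1, P]` with `‖·‖ ≤ 29W₀`,
  `‖(·)′‖ ≤ (94W₀ + 29K_w)α/t` (`Section8AbelProfiles.frakfW_div_bounds` × the layer-3 bounds on `𝓦ˣ_j`);
* `gathered_eval_top` — for fixed large `D`, `χ`, `j`: the substitution `n = dr` and (8.10)
  (`Section8FrontEnd810.sum_antidiagonal_weight`, `eq810_holds`) collapse the gathered main term of
  `core_top` to `L′(1,χ)²[Σ_{⌊P″₁⌋<n<⌈P₃⌉}|χ(n)|λ₀ⱼ(n)φ(n)⁻¹F_A(n) + Σ_{⌈P₃⌉≤n<⌈P₂⌉}(…)F_B(n)]`, and four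
  applications of the §8 evaluation rule `Section8RangeEngine.weighted_sum_integral_eval` (at
  `X = P₃, ⌊P″₁⌋+1, P₂, P₃`) give `= 𝔞(∫_{⌊P″₁⌋+1}^{P₃}F₆dt/t + ∫_{⌊P″₁⌋+1}^{P₂}F₇dt/t) + O(𝓛⁻¹²)`,
  `F₆ = ῑ₃𝓕_{j6}(P₃/t)𝓦ˣ_j(t)/(log P₃ log P₁)`, `F₇ = ῑ₄𝓕_{j7}(P₂/t)𝓦ˣ_j(t)/(log P₂ log P₁)`.

## References

* Y. Zhang, arXiv:2211.02515v1 (2022), §12 (12.13) p. 71, tex L3614–L3622; §8 (8.10)–(8.11) pp. 47–48.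
  [cite: Zhang2022LandauSiegel, §12 (12.13) p. 71]
-/

noncomputable section

open Complex Real ComplexConjugate Finset

namespace Literature.NumberTheory.LFunctions.Zhang2022.Typed.Sec12C

open Literature.NumberTheory.LFunctions.Zhang2022.Skeleton
open Literature.NumberTheory.LFunctions.Zhang2022.Section8AbelProfiles (frakfW_div_bounds mul_bounds)
open Literature.NumberTheory.LFunctions.Zhang2022.Typed.Sec10C.Ranges1422 (alpha_facts
  log_le_of_le_bigP three_le_of_ell log_P2_bounds)

namespace Top1225

/-! ## Profile bounds on `[1, P]` -/

/-- Sum rule with `O(1)`, `O(1/t)` bounds: `c·f + d·g`. [cite: Zhang2022LandauSiegel, §8 (8.11) p. 48] -/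
theorem lincomb_bounds {f g : ℝ → ℂ} {c d : ℂ} {t A B A' B' κ : ℝ} (hf : DifferentiableAt ℝ f t)
    (hg : DifferentiableAt ℝ g t) (nf : ‖f t‖ ≤ A) (ng : ‖g t‖ ≤ B) (nf' : ‖deriv f t‖ ≤ A' / t)
    (ng' : ‖deriv g t‖ ≤ B' / t) (hc : ‖c‖ ≤ κ) (hd : ‖d‖ ≤ κ) (ht : 0 < t) :
    DifferentiableAt ℝ (fun u => c * f u + d * g u) t ∧ ‖c * f t + d * g t‖ ≤ κ * (A + B) ∧
      ‖deriv (fun u => c * f u + d * g u) t‖ ≤ κ * (A' + B') / t := by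
  have hκ : 0 ≤ κ := (norm_nonneg _).trans hc
  refine ⟨(hf.const_mul c).add (hg.const_mul d), ?_, ?_⟩
  · refine (norm_add_le _ _).trans ?_
    rw [norm_mul, norm_mul]
    have i1 := mul_le_mul hc nf (norm_nonneg _) hκ
    have i2 := mul_le_mul hd ng (norm_nonneg _) hκ
    linarith
  · have hd' : HasDerivAt (fun u => c * f u + d * g u) (c * deriv f t + d * deriv g t) t :=
      (hf.hasDerivAt.const_mul c).add (hg.hasDerivAt.const_mul d)
    rw [hd'.deriv]
    refine (norm_add_le _ _).trans ?_
    rw [norm_mul, norm_mul]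
    have i1 := mul_le_mul hc nf' (norm_nonneg _) hκ
    have i2 := mul_le_mul hd ng' (norm_nonneg _) hκ
    have e2 : κ * (A' + B') / t = κ * (A' / t) + κ * (B' / t) := by field_simp
    rw [e2]; linarith

/-- `P₂ + 1 ≤ P`, `P₃ + 1 ≤ P`, `2 ≤ P₃` for `𝓛 ≥ 3`. [cite: Zhang2022LandauSiegel, §2 (2.21)] -/
theorem scales_plus_one {D : ℕ} (hℓ : 3 ≤ ell D) :
    Skeleton.P2 D + 1 ≤ bigP D ∧ Skeleton.P3 D + 1 ≤ bigP D ∧ 2 ≤ Skeleton.P3 D := by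
  have h1 : 1 ≤ ell D := by linarith
  have h0 : 0 < ell D := by linarith
  have hℓ4 : 27 ≤ ell D ^ 9 := by
    have : (3:ℝ) ^ 9 ≤ ell D ^ 9 := pow_le_pow_left₀ (by norm_num) hℓ 9
    nlinarith
  have hP : bigP D = Real.exp (ell D ^ 9) := rfl
  have hP3 : Skeleton.P3 D = Real.exp (0.498 * ell D ^ 9) := by
    rw [Skeleton.P3, bigP, ← Real.exp_mul]; ring_nf
  have hP2le : Skeleton.P2 D ≤ Real.exp (0.5 * ell D ^ 9) := by
    rw [Skeleton.P2]
    have hT1 : 1 ≤ bigT D ^ 10 := one_le_pow₀ (Real.one_le_exp (Real.rpow_nonneg h0.le _))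
    calc bigP D ^ (0.5:ℝ) / bigT D ^ 10 ≤ bigP D ^ (0.5:ℝ) := div_le_self (Real.rpow_nonneg (Real.exp_pos _).le _) hT1
      _ = Real.exp (0.5 * ell D ^ 9) := by rw [bigP, ← Real.exp_mul]; ring_nf
  -- `e^{x} + 1 ≤ e^{y}` when `x + 1 ≤ y` (from `e^y ≥ e^x · e ≥ e^x·2 ≥ e^x + 1` for `e^x ≥ 1`)
  have key : ∀ x y : ℝ, 0 ≤ x → x + 1 ≤ y → Real.exp x + 1 ≤ Real.exp y := by
    intro x y hx hxy
    have hex : 1 ≤ Real.exp x := Real.one_le_exp hx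
    have he1 : (2:ℝ) ≤ Real.exp 1 := by have := Real.add_one_le_exp (1:ℝ); linarith
    calc Real.exp x + 1 ≤ Real.exp x * 2 := by linarith
      _ ≤ Real.exp x * Real.exp 1 := by gcongr
      _ = Real.exp (x + 1) := by rw [Real.exp_add]
      _ ≤ Real.exp y := Real.exp_le_exp.mpr hxy
  refine ⟨?_, ?_, ?_⟩
  · calc Skeleton.P2 D + 1 ≤ Real.exp (0.5 * ell D ^ 9) + 1 := by linarith
      _ ≤ Real.exp (ell D ^ 9) := key _ _ (by positivity) (by nlinarith)
      _ = bigP D := hP.symm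
  · rw [hP3, hP]; exact key _ _ (by positivity) (by nlinarith)
  · rw [hP3]
    have : (2:ℝ) ≤ Real.exp 1 := by have := Real.add_one_le_exp (1:ℝ); linarith
    exact this.trans (Real.exp_le_exp.mpr (by nlinarith))

/-- **The product profiles `t ↦ 𝓕_{jμ}(Q/t)·𝓦ˣ_j(t)` on `[1, P]`** (`Q ∈ [1, P]`, `𝓛 ≥ 3`, `5|c′|α𝓛 ≤ 1`):
differentiable, `‖·‖ ≤ 29W₀`, `‖(·)′‖ ≤ (94W₀ + 29K_w)α/t` with the layer-1/3 constants `W₀`, `K_w`.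
[cite: Zhang2022LandauSiegel, §12 (12.13) p. 71; §8 (8.11) p. 48] -/
theorem profile_bounds (c' : ℝ) {D : ℕ} (hℓ : 3 ≤ ell D) (hc5 : 5 * |c'| * alpha D * ell D ≤ 1)
    (j μ : ℕ) {Q t : ℝ} (hQ1 : 1 ≤ Q) (hQP : Q ≤ bigP D) (ht1 : 1 ≤ t) (htP : t ≤ bigP D) :
    DifferentiableAt ℝ (fun u : ℝ => frakfW c' D j μ (Q / u) * frakwEx c' D j u) t ∧
      ‖frakfW c' D j μ (Q / t) * frakwEx c' D j t‖ ≤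
        29 * (1 + 3 * (3 * π * (1 + 5 * |c'| * π)) + 2 * (3 * π * (1 + 5 * |c'| * π)) ^ 2) ∧
      ‖deriv (fun u : ℝ => frakfW c' D j μ (Q / u) * frakwEx c' D j u) t‖ ≤
        (94 * alpha D * (1 + 3 * (3 * π * (1 + 5 * |c'| * π)) + 2 * (3 * π * (1 + 5 * |c'| * π)) ^ 2) +
          29 * (3 * (1 + 5 * |c'| * π) * (4 + 6 * (3 * π * (1 + 5 * |c'| * π)) +
            2 * (3 * π * (1 + 5 * |c'| * π)) ^ 2) * alpha D)) / t := by
  have h0 : 0 < ell D := by linarith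
  have hα : 0 < alpha D := (alpha_facts hℓ).1
  have hαP : alpha D * Real.log (bigP D) ≤ 4 := by
    rw [Skeleton.log_bigP, (alpha_facts hℓ).2.2]
    have := Real.pi_lt_four; linarith
  obtain ⟨hfd, hfn, hfd'⟩ := frakfW_div_bounds c' j μ hα h0.le hc5 hQ1 hQP ht1 htP hαP
  obtain ⟨hgd, hgd'⟩ := norm_deriv_frakwEx_le c' hℓ j ht1 htP
  have hgn := norm_frakwEx_le c' hℓ j ht1 htP
  exact mul_bounds hfd hgd hfn hgn hfd' hgd' (by norm_num)

/-! ## The gathered main term: (8.10) and the evaluation rule -/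

-- one long assembly (collapse + four engine applications): above the default budget
set_option maxHeartbeats 800000 in
/-- **The gathered main term of the top range, evaluated** (for fixed `D` with `𝓛 ≥ 5`, real primitive
`χ`, `j`, given the §8 evaluation rule at this `D, χ, j` with constant `C_E` and `5|c′|α𝓛 ≤ 1`):
`‖GATHERED − 𝔞·(∫_{Y₁}^{P₃} F₆ dt/t + ∫_{Y₁}^{P₂} F₇ dt/t)‖ ≤ 4·C_E·M₂(c′)·𝓛⁻¹²`, `Y₁ = ⌊P″₁⌋ + 1`,
`F₆(t) = ῑ₃𝓕_{j6}(P₃/t)𝓦ˣ_j(t)/(log P₃·log P₁)`, `F₇(t) = ῑ₄𝓕_{j7}(P₂/t)𝓦ˣ_j(t)/(log P₂·log P₁)`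
((8.10): `Σ_{dr=n}|μ(r)||χ(n)|λ₀ⱼ(n)Π(d,r)/(nφ(r)) = |χ(n)|λ₀ⱼ(n)/φ(n)`; then
`L′²Σ_{n<X}|χ(n)|λ₀ⱼ(n)φ(n)⁻¹F(n) = 𝔞∫₁^X F dt/t + O(𝓛⁶(M + M′𝓛⁹))` with `M ≪ 𝓛⁻¹⁸`, `M′ ≪ α𝓛⁻¹⁸`).
[cite: Zhang2022LandauSiegel, §12 (12.13) p. 71, tex L3614–L3622] -/
theorem gathered_eval_top (c' : ℝ) {D : ℕ} [NeZero D] {χ : DirichletCharacter ℂ D} (hq : χ.IsQuadratic)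
    (hℓ5 : 5 ≤ ell D) (hc5 : 5 * |c'| * alpha D * ell D ≤ 1) (j : ℕ) {CE : ℝ}
    (hE : ∀ (X M M' : ℝ) (F : ℝ → ℂ), 2 ≤ X → X ≤ bigP D → 0 ≤ M → 0 ≤ M' →
        (∀ t ∈ Set.Icc 1 (X + 1), DifferentiableAt ℝ F t) →
        (∀ t ∈ Set.Icc 1 (X + 1), ‖F t‖ ≤ M) →
        (∀ t ∈ Set.Icc 1 (X + 1), ‖deriv F t‖ ≤ M' / t) →
        ‖deriv χ.LFunction 1 ^ 2 *
              (∑ n ∈ Finset.Ico 1 ⌈X⌉₊,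
                (‖χ (n : ZMod D)‖ : ℂ) * lamZero c' D j n / (Nat.totient n : ℂ) * F n) -
            (frakA χ : ℂ) * ∫ t in (1 : ℝ)..X, F t / t‖ ≤
          CE * ell D ^ 6 * (M + M' * ell D ^ 9)) :
    ‖((∑ n ∈ Finset.Ico (⌊P1pp D⌋₊ + 1) ⌈Skeleton.P3 D⌉₊, ∑ p ∈ Nat.divisorsAntidiagonal n,
          ((ArithmeticFunction.moebius p.2).natAbs : ℂ) * (‖χ ((p.1 * p.2 : ℕ) : ZMod D)‖ : ℂ) /
                (((p.1 * p.2 : ℕ) : ℂ) * (Nat.totient p.2 : ℂ)) * lamZero c' D j (p.1 * p.2) *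
            ((conj iota3 * (deriv χ.LFunction 1 / (Real.log (Skeleton.P3 D) : ℂ) *
                  frakfW c' D j 6 (Skeleton.P3 D / ((p.1 * p.2 : ℕ) : ℝ))) +
                conj iota4 * (deriv χ.LFunction 1 / (Real.log (Skeleton.P2 D) : ℂ) *
                  frakfW c' D j 7 (Skeleton.P2 D / ((p.1 * p.2 : ℕ) : ℝ)))) *
              (1 / (Real.log (Skeleton.P1 D) : ℂ) * (deriv χ.LFunction 1 * PiW χ p.1 p.2) *
                frakwEx c' D j ((p.1 * p.2 : ℕ) : ℝ)))) +
        ∑ n ∈ Finset.Ico ⌈Skeleton.P3 D⌉₊ ⌈Skeleton.P2 D⌉₊, ∑ p ∈ Nat.divisorsAntidiagonal n,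
          ((ArithmeticFunction.moebius p.2).natAbs : ℂ) * (‖χ ((p.1 * p.2 : ℕ) : ZMod D)‖ : ℂ) /
                (((p.1 * p.2 : ℕ) : ℂ) * (Nat.totient p.2 : ℂ)) * lamZero c' D j (p.1 * p.2) *
            (conj iota4 * (deriv χ.LFunction 1 / (Real.log (Skeleton.P2 D) : ℂ) *
                frakfW c' D j 7 (Skeleton.P2 D / ((p.1 * p.2 : ℕ) : ℝ))) *
              (1 / (Real.log (Skeleton.P1 D) : ℂ) * (deriv χ.LFunction 1 * PiW χ p.1 p.2) *
                frakwEx c' D j ((p.1 * p.2 : ℕ) : ℝ)))) -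
        (frakA χ : ℂ) *
          ((∫ t in ((⌊P1pp D⌋₊ + 1 : ℕ) : ℝ)..Skeleton.P3 D,
              conj iota3 / ((Real.log (Skeleton.P3 D) : ℂ) * (Real.log (Skeleton.P1 D) : ℂ)) *
                (frakfW c' D j 6 (Skeleton.P3 D / t) * frakwEx c' D j t) / t) +
            ∫ t in ((⌊P1pp D⌋₊ + 1 : ℕ) : ℝ)..Skeleton.P2 D,
              conj iota4 / ((Real.log (Skeleton.P2 D) : ℂ) * (Real.log (Skeleton.P1 D) : ℂ)) *
                (frakfW c' D j 7 (Skeleton.P2 D / t) * frakwEx c' D j t) / t)‖ ≤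
      4 * CE * ((74 * (29 * (1 + 3 * (3 * π * (1 + 5 * |c'| * π)) + 2 * (3 * π * (1 + 5 * |c'| * π)) ^ 2))) +
        (74 * ((94 * (1 + 3 * (3 * π * (1 + 5 * |c'| * π)) + 2 * (3 * π * (1 + 5 * |c'| * π)) ^ 2) +
          29 * (3 * (1 + 5 * |c'| * π) * (4 + 6 * (3 * π * (1 + 5 * |c'| * π)) +
            2 * (3 * π * (1 + 5 * |c'| * π)) ^ 2)))) * π)) / ell D ^ 12 := by
  -- constants
  set W₀ : ℝ := 1 + 3 * (3 * π * (1 + 5 * |c'| * π)) + 2 * (3 * π * (1 + 5 * |c'| * π)) ^ 2 with hW₀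
  set Kw : ℝ := 3 * (1 + 5 * |c'| * π) * (4 + 6 * (3 * π * (1 + 5 * |c'| * π)) +
    2 * (3 * π * (1 + 5 * |c'| * π)) ^ 2) with hKw
  have hW₀0 : 0 ≤ W₀ := by rw [hW₀]; positivity
  have hKw0 : 0 ≤ Kw := by rw [hKw]; positivity
  -- parameters
  have hℓ4 : 4 ≤ ell D := by linarith
  have hℓ : 3 ≤ ell D := by linarith
  have h1 : 1 ≤ ell D := by linarith
  have h0 : 0 < ell D := by linarith
  have hlog1 : 1 ≤ Real.log D := h1
  obtain ⟨hα, hαeq, hα9⟩ := alpha_facts (D := D) hℓ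
  obtain ⟨hlogP3, hlogP3', -, -, -, hP3P⟩ := Section9Gathering.params3 hℓ4
  obtain ⟨hlogP1, hlogP2, -, -, -, -, hP1P, hP2P⟩ := Section8FrontEnd82.params (by linarith : 2 ≤ ell D)
  obtain ⟨-, hP1pp1, hP1ppP3, hP32, -, -, -⟩ := top_range_sizes hℓ5
  obtain ⟨hP2p1, hP3p1, h2P3⟩ := scales_plus_one (D := D) hℓ
  have hP3pos : 0 < Skeleton.P3 D := by linarith
  have hP2pos : 0 < Skeleton.P2 D := by linarith
  have hP1pppos : 0 < P1pp D := by linarith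
  have hlogP1' : ell D ^ 9 / 4 ≤ Real.log (Skeleton.P1 D) := by rw [hlogP1]; nlinarith [pow_pos h0 9]
  have hlogP2' : ell D ^ 9 / 4 ≤ Real.log (Skeleton.P2 D) := by nlinarith [pow_pos h0 9]
  have hlogP1pos : 0 < Real.log (Skeleton.P1 D) := lt_of_lt_of_le (by positivity) hlogP1'
  have hlogP2pos : 0 < Real.log (Skeleton.P2 D) := lt_of_lt_of_le (by positivity) hlogP2'
  have hlogP3pos : 0 < Real.log (Skeleton.P3 D) := lt_of_lt_of_le (by positivity) hlogP3'
  -- Y₁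
  set Y₁ : ℕ := ⌊P1pp D⌋₊ + 1 with hY₁
  have hY₁ge : P1pp D < (Y₁ : ℝ) := by rw [hY₁]; push_cast; exact Nat.lt_floor_add_one _
  have hY₁le : (Y₁ : ℝ) ≤ P1pp D + 1 := by
    rw [hY₁]; push_cast; linarith [Nat.floor_le hP1pppos.le]
  have hY₁2 : (2 : ℝ) ≤ Y₁ := by
    rw [hY₁]; push_cast
    have : (1 : ℝ) ≤ (⌊P1pp D⌋₊ : ℝ) := by exact_mod_cast Nat.le_floor (by exact_mod_cast hP1pp1)
    linarith
  have hY₁P3 : (Y₁ : ℝ) ≤ Skeleton.P3 D := by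
    have : 2 * P1pp D ≤ Skeleton.P3 D := by
      have hT1 : 1 ≤ bigT D := by rw [bigT]; exact Real.one_le_exp (Real.rpow_nonneg h0.le _)
      obtain ⟨h2T, -⟩ := top_range_sizes hℓ5
      nlinarith [hP1pppos]
    linarith
  have hY₁P : (Y₁ : ℝ) ≤ bigP D := hY₁P3.trans hP3P.le
  have hceilY : ⌈(Y₁ : ℝ)⌉₊ = Y₁ := Nat.ceil_natCast _
  have hY₁1 : 1 ≤ Y₁ := by rw [hY₁]; omega
  have hY₁c3 : Y₁ ≤ ⌈Skeleton.P3 D⌉₊ := by exact_mod_cast hY₁P3.trans (Nat.le_ceil _)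
  have hc32 : ⌈Skeleton.P3 D⌉₊ ≤ ⌈Skeleton.P2 D⌉₊ := Nat.ceil_mono hP32
  have h1c3 : 1 ≤ ⌈Skeleton.P3 D⌉₊ := hY₁1.trans hY₁c3
  -- the profiles
  set c₆ : ℂ := conj iota3 / ((Real.log (Skeleton.P3 D) : ℂ) * (Real.log (Skeleton.P1 D) : ℂ)) with hc₆
  set c₇ : ℂ := conj iota4 / ((Real.log (Skeleton.P2 D) : ℂ) * (Real.log (Skeleton.P1 D) : ℂ)) with hc₇
  set g₆ : ℝ → ℂ := fun t => frakfW c' D j 6 (Skeleton.P3 D / t) * frakwEx c' D j t with hg₆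
  set g₇ : ℝ → ℂ := fun t => frakfW c' D j 7 (Skeleton.P2 D / t) * frakwEx c' D j t with hg₇
  set FA : ℝ → ℂ := fun t => c₆ * g₆ t + c₇ * g₇ t with hFA
  set FB : ℝ → ℂ := fun t => 0 * g₆ t + c₇ * g₇ t with hFB
  -- sizes of the constants: ‖c_k‖ ≤ 37/𝓛¹⁸
  have hι3 : ‖iota3‖ ≤ 2.3 := Section9Gathering.norm_iota3_le.trans (by norm_num)
  have hι4 : ‖iota4‖ ≤ 2.3 := Section9Gathering.norm_iota4_le_two.trans (by norm_num)
  set κc : ℝ := 37 / ell D ^ 18 with hκc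
  have hck : ∀ {ι : ℂ} {L : ℝ}, ‖ι‖ ≤ 2.3 → ell D ^ 9 / 4 ≤ L →
      ‖conj ι / ((L : ℂ) * (Real.log (Skeleton.P1 D) : ℂ))‖ ≤ κc := by
    intro ι L hι hL
    have hLpos : 0 < L := lt_of_lt_of_le (by positivity) hL
    rw [norm_div, Complex.norm_conj, norm_mul, Complex.norm_real, Complex.norm_real,
      Real.norm_of_nonneg hLpos.le, Real.norm_of_nonneg hlogP1pos.le, hκc]
    rw [div_le_div_iff₀ (by positivity) (by positivity)]
    have : ell D ^ 18 = ell D ^ 9 * ell D ^ 9 := by ring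
    rw [this]
    have hprod : ell D ^ 9 / 4 * (ell D ^ 9 / 4) ≤ L * Real.log (Skeleton.P1 D) :=
      mul_le_mul hL hlogP1' (by positivity) hLpos.le
    nlinarith [pow_pos h0 9]
  have hc6 : ‖c₆‖ ≤ κc := hck hι3 hlogP3'
  have hc7 : ‖c₇‖ ≤ κc := hck hι4 hlogP2'
  have hc0 : ‖(0 : ℂ)‖ ≤ κc := by rw [norm_zero, hκc]; positivity
  -- profile bounds on `[1, P]`
  have hP31 : 1 ≤ Skeleton.P3 D := by linarith
  have hP21 : 1 ≤ Skeleton.P2 D := by linarith [h2P3]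
  have hprof : ∀ (c d : ℂ), ‖c‖ ≤ κc → ‖d‖ ≤ κc → ∀ t : ℝ, 1 ≤ t → t ≤ bigP D →
      DifferentiableAt ℝ (fun u => c * g₆ u + d * g₇ u) t ∧
        ‖c * g₆ t + d * g₇ t‖ ≤ κc * (29 * W₀ + 29 * W₀) ∧
        ‖deriv (fun u => c * g₆ u + d * g₇ u) t‖ ≤
          κc * ((94 * alpha D * W₀ + 29 * (Kw * alpha D)) + (94 * alpha D * W₀ + 29 * (Kw * alpha D))) / t := by
    intro c d hc hd t ht1 htP
    obtain ⟨d6, n6, d6'⟩ := profile_bounds c' hℓ hc5 j 6 hP31 hP3P.le ht1 htP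
    obtain ⟨d7, n7, d7'⟩ := profile_bounds c' hℓ hc5 j 7 hP21 hP2P.le ht1 htP
    exact lincomb_bounds d6 d7 n6 n7 d6' d7' hc hd (by linarith)
  -- the four engine applications
  set M : ℝ := κc * (29 * W₀ + 29 * W₀) with hM
  set M' : ℝ := κc * ((94 * alpha D * W₀ + 29 * (Kw * alpha D)) + (94 * alpha D * W₀ + 29 * (Kw * alpha D))) with hM'
  have hM0 : 0 ≤ M := by rw [hM, hκc]; positivity
  have hM'0 : 0 ≤ M' := by rw [hM', hκc]; positivity
  have happ : ∀ (c d : ℂ), ‖c‖ ≤ κc → ‖d‖ ≤ κc → ∀ X : ℝ, 2 ≤ X → X + 1 ≤ bigP D →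
      ‖deriv χ.LFunction 1 ^ 2 *
            (∑ n ∈ Finset.Ico 1 ⌈X⌉₊,
              (‖χ (n : ZMod D)‖ : ℂ) * lamZero c' D j n / (Nat.totient n : ℂ) * (c * g₆ n + d * g₇ n)) -
          (frakA χ : ℂ) * ∫ t in (1 : ℝ)..X, (c * g₆ t + d * g₇ t) / t‖ ≤
        CE * ell D ^ 6 * (M + M' * ell D ^ 9) := by
    intro c d hc hd X hX2 hXP
    refine hE X M M' (fun u => c * g₆ u + d * g₇ u) hX2 (by linarith) hM0 hM'0 ?_ ?_ ?_
    · intro t ht; exact (hprof c d hc hd t ht.1 (ht.2.trans hXP)).1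
    · intro t ht; exact (hprof c d hc hd t ht.1 (ht.2.trans hXP)).2.1
    · intro t ht; exact (hprof c d hc hd t ht.1 (ht.2.trans hXP)).2.2
  have E1 := happ c₆ c₇ hc6 hc7 (Skeleton.P3 D) h2P3 hP3p1
  have E2 := happ c₆ c₇ hc6 hc7 (Y₁ : ℝ) hY₁2 (by linarith)
  have E3 := happ 0 c₇ hc0 hc7 (Skeleton.P2 D) (h2P3.trans hP32) hP2p1
  have E4 := happ 0 c₇ hc0 hc7 (Skeleton.P3 D) h2P3 hP3p1
  rw [hceilY] at E2
  -- Step 1: collapse the gathered sums ((8.10))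
  have h810 := Section8FrontEnd810.eq810_holds D χ hq
  have hcollA : ∀ n ∈ Finset.Ico Y₁ ⌈Skeleton.P3 D⌉₊,
      (∑ p ∈ Nat.divisorsAntidiagonal n,
        ((ArithmeticFunction.moebius p.2).natAbs : ℂ) * (‖χ ((p.1 * p.2 : ℕ) : ZMod D)‖ : ℂ) /
              (((p.1 * p.2 : ℕ) : ℂ) * (Nat.totient p.2 : ℂ)) * lamZero c' D j (p.1 * p.2) *
          ((conj iota3 * (deriv χ.LFunction 1 / (Real.log (Skeleton.P3 D) : ℂ) *
                frakfW c' D j 6 (Skeleton.P3 D / ((p.1 * p.2 : ℕ) : ℝ))) +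
              conj iota4 * (deriv χ.LFunction 1 / (Real.log (Skeleton.P2 D) : ℂ) *
                frakfW c' D j 7 (Skeleton.P2 D / ((p.1 * p.2 : ℕ) : ℝ)))) *
            (1 / (Real.log (Skeleton.P1 D) : ℂ) * (deriv χ.LFunction 1 * PiW χ p.1 p.2) *
              frakwEx c' D j ((p.1 * p.2 : ℕ) : ℝ)))) =
      (‖χ (n : ZMod D)‖ : ℂ) * lamZero c' D j n / (Nat.totient n : ℂ) *
        (deriv χ.LFunction 1 ^ 2 * FA n) := by
    intro n hn
    have hn1 : 1 ≤ n := hY₁1.trans (Finset.mem_Ico.mp hn).1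
    rw [← Section8FrontEnd810.sum_antidiagonal_weight χ c' j h810 (by omega) (deriv χ.LFunction 1 ^ 2 * FA n)]
    refine Finset.sum_congr rfl fun p hp => ?_
    obtain ⟨hpn, -⟩ := Nat.mem_divisorsAntidiagonal.mp hp
    have hcast : ((p.1 * p.2 : ℕ) : ℝ) = (n : ℝ) := by rw [hpn]
    simp only [hcast, hFA, hc₆, hc₇, hg₆, hg₇]
    ring
  have hcollB : ∀ n ∈ Finset.Ico ⌈Skeleton.P3 D⌉₊ ⌈Skeleton.P2 D⌉₊,
      (∑ p ∈ Nat.divisorsAntidiagonal n,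
        ((ArithmeticFunction.moebius p.2).natAbs : ℂ) * (‖χ ((p.1 * p.2 : ℕ) : ZMod D)‖ : ℂ) /
              (((p.1 * p.2 : ℕ) : ℂ) * (Nat.totient p.2 : ℂ)) * lamZero c' D j (p.1 * p.2) *
          (conj iota4 * (deriv χ.LFunction 1 / (Real.log (Skeleton.P2 D) : ℂ) *
              frakfW c' D j 7 (Skeleton.P2 D / ((p.1 * p.2 : ℕ) : ℝ))) *
            (1 / (Real.log (Skeleton.P1 D) : ℂ) * (deriv χ.LFunction 1 * PiW χ p.1 p.2) *
              frakwEx c' D j ((p.1 * p.2 : ℕ) : ℝ)))) =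
      (‖χ (n : ZMod D)‖ : ℂ) * lamZero c' D j n / (Nat.totient n : ℂ) *
        (deriv χ.LFunction 1 ^ 2 * FB n) := by
    intro n hn
    have hn1 : 1 ≤ n := h1c3.trans (Finset.mem_Ico.mp hn).1
    rw [← Section8FrontEnd810.sum_antidiagonal_weight χ c' j h810 (by omega) (deriv χ.LFunction 1 ^ 2 * FB n)]
    refine Finset.sum_congr rfl fun p hp => ?_
    obtain ⟨hpn, -⟩ := Nat.mem_divisorsAntidiagonal.mp hp
    have hcast : ((p.1 * p.2 : ℕ) : ℝ) = (n : ℝ) := by rw [hpn]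
    simp only [hcast, hFB, hc₇, hg₆, hg₇]
    ring
  -- the weighted sums
  set wt : ℕ → ℂ := fun n => (‖χ (n : ZMod D)‖ : ℂ) * lamZero c' D j n / (Nat.totient n : ℂ) with hwt
  have hSA : (∑ n ∈ Finset.Ico Y₁ ⌈Skeleton.P3 D⌉₊, ∑ p ∈ Nat.divisorsAntidiagonal n,
          ((ArithmeticFunction.moebius p.2).natAbs : ℂ) * (‖χ ((p.1 * p.2 : ℕ) : ZMod D)‖ : ℂ) /
                (((p.1 * p.2 : ℕ) : ℂ) * (Nat.totient p.2 : ℂ)) * lamZero c' D j (p.1 * p.2) *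
            ((conj iota3 * (deriv χ.LFunction 1 / (Real.log (Skeleton.P3 D) : ℂ) *
                  frakfW c' D j 6 (Skeleton.P3 D / ((p.1 * p.2 : ℕ) : ℝ))) +
                conj iota4 * (deriv χ.LFunction 1 / (Real.log (Skeleton.P2 D) : ℂ) *
                  frakfW c' D j 7 (Skeleton.P2 D / ((p.1 * p.2 : ℕ) : ℝ)))) *
              (1 / (Real.log (Skeleton.P1 D) : ℂ) * (deriv χ.LFunction 1 * PiW χ p.1 p.2) *
                frakwEx c' D j ((p.1 * p.2 : ℕ) : ℝ)))) =
      deriv χ.LFunction 1 ^ 2 * (∑ n ∈ Finset.Ico 1 ⌈Skeleton.P3 D⌉₊, wt n * FA n) -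
        deriv χ.LFunction 1 ^ 2 * (∑ n ∈ Finset.Ico 1 Y₁, wt n * FA n) := by
    rw [Finset.sum_congr rfl hcollA, ← mul_sub, ← Finset.sum_Ico_consecutive _ hY₁1 hY₁c3,
      add_sub_cancel_left, Finset.mul_sum]
    refine Finset.sum_congr rfl fun n _ => ?_
    simp only [hwt]; ring
  have hSB : (∑ n ∈ Finset.Ico ⌈Skeleton.P3 D⌉₊ ⌈Skeleton.P2 D⌉₊, ∑ p ∈ Nat.divisorsAntidiagonal n,
          ((ArithmeticFunction.moebius p.2).natAbs : ℂ) * (‖χ ((p.1 * p.2 : ℕ) : ZMod D)‖ : ℂ) /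
                (((p.1 * p.2 : ℕ) : ℂ) * (Nat.totient p.2 : ℂ)) * lamZero c' D j (p.1 * p.2) *
            (conj iota4 * (deriv χ.LFunction 1 / (Real.log (Skeleton.P2 D) : ℂ) *
                frakfW c' D j 7 (Skeleton.P2 D / ((p.1 * p.2 : ℕ) : ℝ))) *
              (1 / (Real.log (Skeleton.P1 D) : ℂ) * (deriv χ.LFunction 1 * PiW χ p.1 p.2) *
                frakwEx c' D j ((p.1 * p.2 : ℕ) : ℝ)))) =
      deriv χ.LFunction 1 ^ 2 * (∑ n ∈ Finset.Ico 1 ⌈Skeleton.P2 D⌉₊, wt n * FB n) -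
        deriv χ.LFunction 1 ^ 2 * (∑ n ∈ Finset.Ico 1 ⌈Skeleton.P3 D⌉₊, wt n * FB n) := by
    rw [Finset.sum_congr rfl hcollB, ← mul_sub, ← Finset.sum_Ico_consecutive _ h1c3 hc32,
      add_sub_cancel_left, Finset.mul_sum]
    refine Finset.sum_congr rfl fun n _ => ?_
    simp only [hwt]; ring
  -- the integrals: ∫₁^{P₃} − ∫₁^{Y₁} = ∫_{Y₁}^{P₃}, and `FA = F₆ + FB` under the integral
  have hcont : ∀ (c d : ℂ), ‖c‖ ≤ κc → ‖d‖ ≤ κc →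
      ContinuousOn (fun t : ℝ => (c * g₆ t + d * g₇ t) / t) (Set.Icc 1 (bigP D)) := by
    intro c d hc hd t ht
    have hdiff := (hprof c d hc hd t ht.1 ht.2).1
    have ht0 : (t : ℂ) ≠ 0 := by exact_mod_cast (by linarith [ht.1] : t ≠ 0)
    exact (hdiff.continuousAt.div (Complex.continuous_ofReal.continuousAt) ht0).continuousWithinAt
  have hint : ∀ (c d : ℂ), ‖c‖ ≤ κc → ‖d‖ ≤ κc → ∀ a b : ℝ, 1 ≤ a → a ≤ bigP D → 1 ≤ b → b ≤ bigP D →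
      IntervalIntegrable (fun t : ℝ => (c * g₆ t + d * g₇ t) / t) MeasureTheory.volume a b := by
    intro c d hc hd a b ha haP hb hbP
    refine ((hcont c d hc hd).mono ?_).intervalIntegrable
    intro t ht
    rcases le_total a b with hab | hab
    · rw [Set.uIcc_of_le hab] at ht; exact ⟨ha.trans ht.1, ht.2.trans hbP⟩
    · rw [Set.uIcc_of_ge hab] at ht; exact ⟨hb.trans ht.1, ht.2.trans haP⟩
  have hIA : (∫ t in (1:ℝ)..Skeleton.P3 D, (c₆ * g₆ t + c₇ * g₇ t) / t) -
      (∫ t in (1:ℝ)..(Y₁ : ℝ), (c₆ * g₆ t + c₇ * g₇ t) / t) =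
      ∫ t in (Y₁ : ℝ)..Skeleton.P3 D, (c₆ * g₆ t + c₇ * g₇ t) / t :=
    intervalIntegral.integral_interval_sub_left (hint c₆ c₇ hc6 hc7 1 _ le_rfl (by linarith) hP31 hP3P.le)
      (hint c₆ c₇ hc6 hc7 1 _ le_rfl (by linarith) (by linarith) hY₁P)
  have hIB : (∫ t in (1:ℝ)..Skeleton.P2 D, (0 * g₆ t + c₇ * g₇ t) / t) -
      (∫ t in (1:ℝ)..Skeleton.P3 D, (0 * g₆ t + c₇ * g₇ t) / t) =
      ∫ t in Skeleton.P3 D..Skeleton.P2 D, (0 * g₆ t + c₇ * g₇ t) / t :=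
    intervalIntegral.integral_interval_sub_left (hint 0 c₇ hc0 hc7 1 _ le_rfl (by linarith) hP21 hP2P.le)
      (hint 0 c₇ hc0 hc7 1 _ le_rfl (by linarith) hP31 hP3P.le)
  -- split `FA = F₆ + F₇` inside `∫_{Y₁}^{P₃}` and recombine `∫_{Y₁}^{P₃}F₇ + ∫_{P₃}^{P₂}F₇ = ∫_{Y₁}^{P₂}F₇`
  have hi6 : IntervalIntegrable (fun t : ℝ => (c₆ * g₆ t + 0 * g₇ t) / t) MeasureTheory.volume (Y₁ : ℝ)
      (Skeleton.P3 D) := hint c₆ 0 hc6 hc0 _ _ (by linarith) hY₁P hP31 hP3P.le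
  have hi7a : IntervalIntegrable (fun t : ℝ => (0 * g₆ t + c₇ * g₇ t) / t) MeasureTheory.volume (Y₁ : ℝ)
      (Skeleton.P3 D) := hint 0 c₇ hc0 hc7 _ _ (by linarith) hY₁P hP31 hP3P.le
  have hi7b : IntervalIntegrable (fun t : ℝ => (0 * g₆ t + c₇ * g₇ t) / t) MeasureTheory.volume
      (Skeleton.P3 D) (Skeleton.P2 D) := hint 0 c₇ hc0 hc7 _ _ hP31 hP3P.le hP21 hP2P.le
  have hsplit : (∫ t in (Y₁ : ℝ)..Skeleton.P3 D, (c₆ * g₆ t + c₇ * g₇ t) / t) =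
      (∫ t in (Y₁ : ℝ)..Skeleton.P3 D, (c₆ * g₆ t + 0 * g₇ t) / t) +
        ∫ t in (Y₁ : ℝ)..Skeleton.P3 D, (0 * g₆ t + c₇ * g₇ t) / t := by
    rw [← intervalIntegral.integral_add hi6 hi7a]
    refine intervalIntegral.integral_congr fun t _ => ?_
    ring
  have hjoin : (∫ t in (Y₁ : ℝ)..Skeleton.P3 D, (0 * g₆ t + c₇ * g₇ t) / t) +
      (∫ t in Skeleton.P3 D..Skeleton.P2 D, (0 * g₆ t + c₇ * g₇ t) / t) =
      ∫ t in (Y₁ : ℝ)..Skeleton.P2 D, (0 * g₆ t + c₇ * g₇ t) / t :=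
    intervalIntegral.integral_add_adjacent_intervals hi7a hi7b
  -- identify the target integrals
  have hT6 : (∫ t in ((⌊P1pp D⌋₊ + 1 : ℕ) : ℝ)..Skeleton.P3 D,
        conj iota3 / ((Real.log (Skeleton.P3 D) : ℂ) * (Real.log (Skeleton.P1 D) : ℂ)) *
          (frakfW c' D j 6 (Skeleton.P3 D / t) * frakwEx c' D j t) / t) =
      ∫ t in (Y₁ : ℝ)..Skeleton.P3 D, (c₆ * g₆ t + 0 * g₇ t) / t := by
    refine intervalIntegral.integral_congr fun t _ => ?_
    simp only [hc₆, hg₆]; ring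
  have hT7 : (∫ t in ((⌊P1pp D⌋₊ + 1 : ℕ) : ℝ)..Skeleton.P2 D,
        conj iota4 / ((Real.log (Skeleton.P2 D) : ℂ) * (Real.log (Skeleton.P1 D) : ℂ)) *
          (frakfW c' D j 7 (Skeleton.P2 D / t) * frakwEx c' D j t) / t) =
      ∫ t in (Y₁ : ℝ)..Skeleton.P2 D, (0 * g₆ t + c₇ * g₇ t) / t := by
    refine intervalIntegral.integral_congr fun t _ => ?_
    simp only [hc₇, hg₇]; ring
  -- assemble
  rw [hSA, hSB, hT6, hT7, ← hjoin]
  have key : deriv χ.LFunction 1 ^ 2 * (∑ n ∈ Finset.Ico 1 ⌈Skeleton.P3 D⌉₊, wt n * FA n) -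
        deriv χ.LFunction 1 ^ 2 * (∑ n ∈ Finset.Ico 1 Y₁, wt n * FA n) +
        (deriv χ.LFunction 1 ^ 2 * (∑ n ∈ Finset.Ico 1 ⌈Skeleton.P2 D⌉₊, wt n * FB n) -
          deriv χ.LFunction 1 ^ 2 * (∑ n ∈ Finset.Ico 1 ⌈Skeleton.P3 D⌉₊, wt n * FB n)) -
        (frakA χ : ℂ) * ((∫ t in (Y₁ : ℝ)..Skeleton.P3 D, (c₆ * g₆ t + 0 * g₇ t) / t) +
          ((∫ t in (Y₁ : ℝ)..Skeleton.P3 D, (0 * g₆ t + c₇ * g₇ t) / t) +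
            ∫ t in Skeleton.P3 D..Skeleton.P2 D, (0 * g₆ t + c₇ * g₇ t) / t)) =
      (deriv χ.LFunction 1 ^ 2 * (∑ n ∈ Finset.Ico 1 ⌈Skeleton.P3 D⌉₊, wt n * FA n) -
          (frakA χ : ℂ) * ∫ t in (1:ℝ)..Skeleton.P3 D, (c₆ * g₆ t + c₇ * g₇ t) / t) -
        (deriv χ.LFunction 1 ^ 2 * (∑ n ∈ Finset.Ico 1 Y₁, wt n * FA n) -
          (frakA χ : ℂ) * ∫ t in (1:ℝ)..(Y₁:ℝ), (c₆ * g₆ t + c₇ * g₇ t) / t) +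
        ((deriv χ.LFunction 1 ^ 2 * (∑ n ∈ Finset.Ico 1 ⌈Skeleton.P2 D⌉₊, wt n * FB n) -
            (frakA χ : ℂ) * ∫ t in (1:ℝ)..Skeleton.P2 D, (0 * g₆ t + c₇ * g₇ t) / t) -
          (deriv χ.LFunction 1 ^ 2 * (∑ n ∈ Finset.Ico 1 ⌈Skeleton.P3 D⌉₊, wt n * FB n) -
            (frakA χ : ℂ) * ∫ t in (1:ℝ)..Skeleton.P3 D, (0 * g₆ t + c₇ * g₇ t) / t)) := by
    linear_combination (frakA χ : ℂ) * (hIA + hIB + hsplit)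
  rw [key]
  have hFAe : ∀ n : ℕ, wt n * FA n =
      (‖χ (n : ZMod D)‖ : ℂ) * lamZero c' D j n / (Nat.totient n : ℂ) * (c₆ * g₆ n + c₇ * g₇ n) :=
    fun n => rfl
  have hFBe : ∀ n : ℕ, wt n * FB n =
      (‖χ (n : ZMod D)‖ : ℂ) * lamZero c' D j n / (Nat.totient n : ℂ) * (0 * g₆ n + c₇ * g₇ n) :=
    fun n => rfl
  simp only [hFAe, hFBe]
  refine (norm_add_le _ _).trans ?_
  refine (add_le_add ((norm_sub_le _ _).trans (add_le_add E1 E2))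
    ((norm_sub_le _ _).trans (add_le_add E3 E4))).trans ?_
  -- numeric: 4·CE·ℓ⁶(M + M′ℓ⁹) = 4 CE (74·29W₀ + 74(94W₀+29Kw)·αℓ⁹)/ℓ¹²
  have hMe : ell D ^ 6 * (M + M' * ell D ^ 9) =
      (74 * (29 * W₀) + 74 * ((94 * W₀ + 29 * Kw)) * (alpha D * ell D ^ 9)) / ell D ^ 12 := by
    rw [hM, hM', hκc]
    field_simp
    ring
  rw [hα9] at hMe
  have : CE * ell D ^ 6 * (M + M' * ell D ^ 9) + CE * ell D ^ 6 * (M + M' * ell D ^ 9) +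
      (CE * ell D ^ 6 * (M + M' * ell D ^ 9) + CE * ell D ^ 6 * (M + M' * ell D ^ 9)) =
      4 * CE * (ell D ^ 6 * (M + M' * ell D ^ 9)) := by ring
  rw [this, hMe]
  apply le_of_eq
  simp only [hW₀, hKw]
  ring

end Top1225

end Literature.NumberTheory.LFunctions.Zhang2022.Typed.Sec12C
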